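import Literature.NumberTheory.LFunctions.ExplicitZeroFreeRegion
import Literature.NumberTheory.LFunctions.VinogradovKorobovInputs
import Literature.NumberTheory.LFunctions.ZetaZeroFreeRegion
import HarnessLib

/-!
# Inputs of the explicit classical zero-free region (Mossinghoff–Trudgian–Yang 2024, Thm. 1.3, §9)

Topic `Literature/NumberTheory/LFunctions`; second file of the decomposition of the named fact
`Literature.NumberTheory.LFunctions.zero_free_region_mossinghoff_trudgian_yang` (rh.S09, explicit
form: `ζ(σ + it) ≠ 0` for `|t| ≥ 2`, `σ ≥ 1 − 1/(5.558691 log|t|)`; Mossinghoff–Trudgian–Yang,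
*Res. Number Theory* 10 (2024) = arXiv:2212.06867, **Theorem 1.3**, proved in §9 there).
`ExplicitZeroFreeRegion.lean` reduces the theorem to the two leaves of its printed proof,
(A) `platt_trudgian_numerical_rh` (RH to height `3·10¹²`, a certified computation) and
(B) `zero_free_region_mossinghoff_trudgian_yang_large_height` (the Kadiri–Mossinghoff–Trudgian
iteration, `t > 3·10¹²`), and proves (A) → (B) → Thm. 1.3.

## Status of the discharge (2026-08-14): not discharged — XL, blocked on a computation

Leaf (A) is the Platt–Trudgian verification of RH for the lowest `1.2·10¹³` zeros
(`RHWave0NumericalRHProofs.lean`: reduced to the count-form fact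
`Literature.NumberTheory.DiophantineGeometry.zetaZeroCount_platt_trudgian`; no kernel-checkable
certificate exists or is feasible at that scale). It cannot be traded for analysis: the region
of Theorem 1.3 at heights `t ≤ 3·10¹²` is certified in print ONLY by RH-verification — Kadiri's
method run from a lower verified height `T₀` yields a larger constant (`R₀ = 5.69693` from
`T₀ ≈ 3.3·10⁹` in Kadiri 2005; `5.573412` from `T₀ = 3.06·10¹⁰` and `5.5666305` from
`T₀ = 3·10¹¹` in Mossinghoff–Trudgian 2015, §6.1; the empirical law `R₀ ≈ 5.4912 + 2.0185/log T₀`,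
ibid.). Leaf (B) is two papers of explicit analytic number theory (Kadiri 2005; Mossinghoff–
Trudgian 2015, §§2–4: smoothed explicit formula with a Heath-Brown kernel, explicit digamma and
zero-sum bounds, the error term `C(η) = C₁ + ⋯ + C₄`) ending in a certified seven-round numerical
iteration (MTY §9 and its table of iterates). So `zero_free_region_mossinghoff_trudgian_yang_holds` is out of reach;
dependents keep `(h : zero_free_region_mossinghoff_trudgian_yang)`.
*Update (2026-08-15):* the analytic leaf (B) has since been PROVED in the tree from (A) alone by
four certified rounds of the method at `T₀ = 3·10¹²` (`KadiriNumericsFinal.lean`,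
`ExplicitZeroFreeRegionRoundsProofs.lean`: `zero_free_region_mossinghoff_trudgian_yang_of_numerical_rh_only`),
so Theorem 1.3, and with it every classical region with constant `R ≥ 5.558691`, is now
conditional on the computational leaf (A) only.

## What this file adds (everything below is PROVED; no named fact is introduced)

MTY §9 runs "the method detailed in [Mossinghoff–Trudgian 2015]" with three inputs: "the admissible
non-negative trigonometric polynomial of degree 16 from [MT2015], the auxiliary function
`h^{(1)}_{λ,θ}(u)` from (9.2), and the new value for `T₀`", started from "the initial upper bound
`R₀ = 5.573412`" (MT2015, Thm. 1, in turn started from `R = 5.7`, admissible by Kadiri's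
`R₀ = 5.69693`). Accordingly:

* `HasClassicalZeroFreeRegion R` — the de la Vallée Poussin-shaped region with constant `R`
  (`|t| ≥ 2`, `σ ≥ 1 − 1/(R log|t|)`), monotone in `R` (`HasClassicalZeroFreeRegion.mono`); the
  three explicit constants in the literature chain are its instances `5.558691` (MTY Thm. 1.3,
  `Iff.rfl` with the named fact `zero_free_region_mossinghoff_trudgian_yang`), **(B₀)** `5.573412`
  (MT2015 Thm. 1, stated there in the OPEN variant `σ > 1 − 1/(5.573412 log|t|)`, which is spelled
  out verbatim below and is the instance `HasOpenClassicalZeroFreeRegion 5.573412` of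
  `ExplicitZeroFreeRegionKernel.lean`; D-0026 review of the decomposition, 2026-08-15: NO LONGER a
  named fact — it is PROVED from leaf (A) alone in `ExplicitZeroFreeRegionRoundsProofs.lean`,
  `zero_free_region_mossinghoff_trudgian_2015_of_numerical_rh`, and it is a corollary of Thm. 1.3,
  `zero_free_region_mossinghoff_trudgian_2015_of_mossinghoff_trudgian_yang`, so as a separate
  `Prop`-valued definition it carried no trust content beyond (A)) and
  **(B₁)** `5.69693`, Kadiri 2005, Théorème 1.1 (the starting region of the MT2015 iteration),
  which is recorded ONLY as the predicate instance `HasClassicalZeroFreeRegion 5.69693` with the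
  proved implications MTY ⇒ MT2015 ⇒ Kadiri (`zero_free_region_kadiri_of_mossinghoff_trudgian_2015`,
  `zero_free_region_kadiri_of_mossinghoff_trudgian_yang`) — NOT as a named fact (D-0026 review of
  the decomposition, 2026-08-15: as a statement it is a corollary of either vendored theorem by
  monotonicity in the constant, so it carries no content of its own for users; as a proof
  obligation it is as hard as Theorem 1.3 itself — RH verified to `T₀ = 3 330 657 430.697`
  (Wedeniwski), Kadiri's Props. 2.1–2.6 and a certified six-round iteration from Rosser–Schoenfeld's
  `R = 9.645908801`, MT2015 §2 — and it is not an input of the proved glue (A) + (B) ⇒ Thm. 1.3 of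
  `ExplicitZeroFreeRegion.lean`; where the printed architecture of MT2015 uses it as the "already
  established" region it is the hypothesis `(h : HasClassicalZeroFreeRegion 5.69693)`, see
  `ExplicitZeroFreeRegionProofs.lean`); the predicate is vacuous for
  `R ≤ 0` (`hasClassicalZeroFreeRegion_of_nonpos`), rh.S09 (`zero_free_region_classical`) is
  literally `∃ R > 0, HasClassicalZeroFreeRegion R`
  (`zero_free_region_classical_iff_exists_hasClassicalZeroFreeRegion`), hence holds outright by
  the tree's `zero_free_region_classical_holds` (`exists_hasClassicalZeroFreeRegion`).
* (companion file `MossinghoffTrudgianPolynomial.lean`, proved there:) the degree-16 polynomial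
  `F₁₆` of MT2015, Table 3, is admissible — all `a_k ≥ 0`, `a_1 > a_0 = 1`, `F₁₆ ≥ 0`
  (`Literature.NumberTheory.LFunctions.isNonnegTrigPoly_mtA16`).
* **(9.2) of MTY, with the two identities asserted in §9 proved:** the Heath-Brown/Jang–Kwon
  kernel `mtyH1 λ θ u = h^{(1)}_{λ,θ}(u)`; `g₁(θ) = h^{(1)}_{1,θ}(0) = (θ tan θ + 3θ cot θ − 3) sec²θ`
  (`mtyH1_one_zero`; this is `w(0)` of MTY (4.3), the tree's `fordSmoothW0 θ`), and the support
  endpoint `d₁(θ) = 2θ cot θ`: `h^{(1)}_{λ,θ}(2θ cot θ/λ) = 0` (`mtyH1_d1`).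

Not vendored (deliberately): the master inequality `R₀ ≤ A g₁(θ)(1 − κ)/(2(K(w,θ) − C(η)))`
(MT2015 (2.2)/(3.1)) — its error term `C(η)` is assembled from numerically evaluated quantities
(`c₃₀(t,t₀)` from a list of zeros up to `t₀ = 10⁵`, `M_k(θ)`, the `C₄₁` integrals) that the
sources do not print in closed form, so no faithful self-contained statement is available; and the
Platt–Trudgian height (A), see above.

## References

* M. J. Mossinghoff, T. S. Trudgian, A. Yang, *Explicit zero-free regions for the Riemann
  zeta-function*, Res. Number Theory 10 (2024), no. 11 = arXiv:2212.06867: Thm. 1.3, §9 (p. 17: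
  inputs of the run, (9.2), `d₁`, `g₁`), (4.3). [cite: MossinghoffTrudgianYangRNT2024]
* M. J. Mossinghoff, T. S. Trudgian, *Nonnegative trigonometric polynomials and a zero-free region
  for the Riemann zeta-function*, J. Number Theory 157 (2015) 329–349 = arXiv:1410.3926: Thm. 1,
  §2 (Kadiri's method, `R = 5.7`, `r = 5`), §3, §5 (`a_0 = Σ c_j²`, `a_k = 2 Σ c_j c_{j+k}`),
  §6 and Table 3 (`F₁₆`), §6.1. [cite: MossinghoffTrudgian2015]
* H. Kadiri, *Une région explicite sans zéros pour la fonction ζ de Riemann*, Acta Arith. 117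
  (2005) 303–339, Théorème 1.1 (`R₀ = 5.69693`; the arXiv text math/0401238 prints `5.70176`).
  [cite: Kadiri2005]
-/

noncomputable section

open Complex Real

namespace Literature.NumberTheory.LFunctions

/-! ## The classical region with constant `R` -/

/-- The classical zero-free region of the Riemann zeta-function **with constant `R`**, in the
closed form of Kadiri 2005 (Thm. 1.1) and Mossinghoff–Trudgian–Yang 2024 (Thm. 1.3):
`ζ(σ + it) ≠ 0` whenever `|t| ≥ 2` and `σ ≥ 1 − 1/(R log|t|)` ("a classical zero-free region",
Mossinghoff–Trudgian 2015, §1 and Table 1, which lists the admissible `R₀` from de la Vallée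
Poussin's `30.4679` to Kadiri's `5.69693`). A predicate on `R`, not a claim; it carries
content only for `R > 0` (for `R ≤ 0` it is vacuously true — `1/(R log|t|) ≤ 0`, with Lean's
`1/0 = 0` at `R = 0`, puts the region inside `σ ≥ 1` — `hasClassicalZeroFreeRegion_of_nonpos`),
and rh.S09 (`zero_free_region_classical`) is `∃ R > 0, HasClassicalZeroFreeRegion R`
(`zero_free_region_classical_iff_exists_hasClassicalZeroFreeRegion`).
[cite: MossinghoffTrudgian2015, §1 and Table 1] -/
def HasClassicalZeroFreeRegion (R : ℝ) : Prop :=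
  ∀ σ t : ℝ, 2 ≤ |t| → 1 - 1 / (R * Real.log |t|) ≤ σ → riemannZeta (σ + t * I) ≠ 0

/-- Monotonicity in the constant: for `0 < R ≤ R'` the region with constant `R'` is contained in
the one with constant `R` (`1/(R' log|t|) ≤ 1/(R log|t|)` as `log|t| ≥ log 2 > 0`), so
`HasClassicalZeroFreeRegion R → HasClassicalZeroFreeRegion R'`. This is the (trivial) sense in
which each line of Table 1 of Mossinghoff–Trudgian 2015 implies the previous ones.
[cite: MossinghoffTrudgian2015, §1 and Table 1] -/
theorem HasClassicalZeroFreeRegion.mono {R R' : ℝ} (hR : 0 < R) (hRR' : R ≤ R')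
    (h : HasClassicalZeroFreeRegion R) : HasClassicalZeroFreeRegion R' := by
  intro σ t ht hσ
  refine h σ t ht ?_
  have hlog : 0 < Real.log |t| :=
    (Real.log_pos one_lt_two).trans_le (Real.log_le_log two_pos ht)
  have hle : 1 / (R' * Real.log |t|) ≤ 1 / (R * Real.log |t|) :=
    one_div_le_one_div_of_le (by positivity) (by nlinarith)
  linarith

/-- In the region with constant `R > 0` one has `σ > 1/2` as soon as `R log 2 > 2`, i.e. for
`R ≥ 2.9` (as `log 2 > 0.6931471803`, `Real.log_two_gt_d9`); in particular every constant of
Table 1 of Mossinghoff–Trudgian 2015 describes a region strictly to the right of the critical line.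
[cite: MossinghoffTrudgian2015, Table 1] -/
theorem one_half_lt_of_hasClassicalZeroFreeRegion_hyp {R σ t : ℝ} (hR : 2.9 ≤ R) (ht : 2 ≤ |t|)
    (hσ : 1 - 1 / (R * Real.log |t|) ≤ σ) : 1 / 2 < σ := by
  have hlog2 : (0.6931471803 : ℝ) < Real.log 2 := Real.log_two_gt_d9
  have hlog : Real.log 2 ≤ Real.log |t| := Real.log_le_log two_pos ht
  have hpos : (2 : ℝ) < R * Real.log |t| := by nlinarith
  have hlt : 1 / (R * Real.log |t|) < 1 / 2 := one_div_lt_one_div_of_lt two_pos hpos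
  linarith

/-- Theorem 1.3 of Mossinghoff–Trudgian–Yang (`zero_free_region_mossinghoff_trudgian_yang`,
rh.S09 explicit) is, verbatim, the classical region with constant `R = 5.558691`.
[cite: MossinghoffTrudgianYangRNT2024, Theorem 1.3] -/
theorem hasClassicalZeroFreeRegion_iff_mossinghoff_trudgian_yang :
    HasClassicalZeroFreeRegion 5.558691 ↔ zero_free_region_mossinghoff_trudgian_yang :=
  Iff.rfl

/-- **(B₀) Theorem 1 of Mossinghoff–Trudgian 2015, verbatim** — "There are no zeros of
`ζ(σ + it)` for `|t| ≥ 2` and `σ > 1 − 1/(5.573412 log|t|)`" (the strict inequality of the printed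
theorem; the abstract has `≥`) — follows from the closed region with the same constant. The
conclusion is spelled out here (this file cannot see `HasOpenClassicalZeroFreeRegion 5.573412` of
`ExplicitZeroFreeRegionKernel.lean`, to which it is definitionally equal); it is proved from leaf (A)
alone in `ExplicitZeroFreeRegionRoundsProofs.lean`
(`zero_free_region_mossinghoff_trudgian_2015_of_numerical_rh`).
[cite: MossinghoffTrudgian2015, Theorem 1] -/
theorem zero_free_region_mossinghoff_trudgian_2015_of_hasClassicalZeroFreeRegion
    (h : HasClassicalZeroFreeRegion 5.573412) :
    ∀ σ t : ℝ, 2 ≤ |t| → 1 - 1 / (5.573412 * Real.log |t|) < σ → riemannZeta (σ + t * I) ≠ 0 :=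
  fun σ t ht hσ ↦ h σ t ht hσ.le

/-- Conversely the open region of Theorem 1 of Mossinghoff–Trudgian 2015 gives the closed region
with any larger constant `R' > 5.573412`. [cite: MossinghoffTrudgian2015, Theorem 1] -/
theorem hasClassicalZeroFreeRegion_of_mossinghoff_trudgian_2015
    (h : ∀ σ t : ℝ, 2 ≤ |t| → 1 - 1 / (5.573412 * Real.log |t|) < σ → riemannZeta (σ + t * I) ≠ 0)
    {R' : ℝ} (hR' : 5.573412 < R') :
    HasClassicalZeroFreeRegion R' := by
  intro σ t ht hσ
  refine h σ t ht ?_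
  have hlog : 0 < Real.log |t| :=
    (Real.log_pos one_lt_two).trans_le (Real.log_le_log two_pos ht)
  have hlt : 1 / (R' * Real.log |t|) < 1 / (5.573412 * Real.log |t|) :=
    one_div_lt_one_div_of_lt (by positivity) (by nlinarith)
  linarith

/-! ## (B₁) Kadiri's region `R₀ = 5.69693`, the starting constant of the iteration (a corollary, not a named fact) -/

/-- **(B₁) Kadiri's region from Theorem 1 of Mossinghoff–Trudgian 2015.** Kadiri 2005,
Théorème 1.1 (Principal), verbatim: "La fonction `ζ` de Riemann ne s'annule jamais dans la région
`Re s ≥ 1 − 1/(R₀ log|Im s|)`, `|Im s| ≥ 2`, avec `R₀ = 5.69693`" (the constant of the published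
version, as cited in Mossinghoff–Trudgian 2015, §1 and Table 1, and Mossinghoff–Trudgian–Yang
2024, §9; the arXiv text math/0401238 of the same theorem prints the weaker `R₀ = 5.70176`) — in
the tree, the predicate instance `HasClassicalZeroFreeRegion 5.69693`. Printed proof: Kadiri's
global explicit-formula method with the Heath-Brown kernel `h^{(4)}_{1,θ}`, `θ = 1.848`, a
degree-4 polynomial, `r = 5`, `t₀ = 10`, the starting region `R = 9.645908801` of
Rosser–Schoenfeld (Math. Comp. 29 (1975)) and RH verified to `T₀ = 3 330 657 430.697`
(Wedeniwski), and an iterative procedure (as re-run in Mossinghoff–Trudgian 2015, §2, six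
iterations give `5.696924…`). Role in the chain: `R = 5.7 ≥ 5.69693` is the initial upper bound
of the Mossinghoff–Trudgian 2015 iteration (op. cit. §3: "a positive constant for which the
classical zero-free region … has already been established"), whose output `5.573412` starts the
iteration of MTY §9. **Status in the tree (D-0026 review of the decomposition of Thm. 1.3,
2026-08-15): deliberately NOT a named fact.** As a statement it is a corollary, by monotonicity in
the constant, of either vendored later theorem — this theorem (`5.573412 < 5.69693`) and
`zero_free_region_kadiri_of_mossinghoff_trudgian_yang` — so users needing Kadiri's region take
`(h : zero_free_region_mossinghoff_trudgian_yang)` (or `(h : HasClassicalZeroFreeRegion 5.69693)`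
where the printed MT2015 architecture is being recorded, `ExplicitZeroFreeRegionProofs.lean`); as
a proof obligation it is of the same size as Theorem 1.3 itself (a numerical RH verification of
Wedeniwski's height, Kadiri's Props. 2.1–2.6, certified numerics) and it is not an input of the
proved glue (A) + (B) ⇒ Thm. 1.3 (`ExplicitZeroFreeRegion.lean`).
[cite: MossinghoffTrudgian2015, Theorem 1, §1 Table 1 and §§2–3 (R = 5.7, r = 5)]
[cite: Kadiri2005, Théorème 1.1] -/
theorem zero_free_region_kadiri_of_mossinghoff_trudgian_2015
    (h : ∀ σ t : ℝ, 2 ≤ |t| → 1 - 1 / (5.573412 * Real.log |t|) < σ → riemannZeta (σ + t * I) ≠ 0) :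
    HasClassicalZeroFreeRegion 5.69693 :=
  hasClassicalZeroFreeRegion_of_mossinghoff_trudgian_2015 h (by norm_num)

/-- Theorem 1.3 of Mossinghoff–Trudgian–Yang (`R₀ = 5.558691`) contains Kadiri's Théorème 1.1
(`R₀ = 5.69693`, `HasClassicalZeroFreeRegion 5.69693`).
[cite: MossinghoffTrudgianYangRNT2024, Theorem 1.3] [cite: Kadiri2005, Théorème 1.1] -/
theorem zero_free_region_kadiri_of_mossinghoff_trudgian_yang
    (h : zero_free_region_mossinghoff_trudgian_yang) : HasClassicalZeroFreeRegion 5.69693 :=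
  HasClassicalZeroFreeRegion.mono (R := 5.558691) (by norm_num) (by norm_num) h

/-- The arXiv form of Kadiri's theorem (`R₀ = 5.70176`, math/0401238, Théorème 1.1) from the
published one (`5.69693 ≤ 5.70176`). [cite: Kadiri2005, Théorème 1.1 (arXiv math/0401238: R₀ = 5.70176)] -/
theorem hasClassicalZeroFreeRegion_kadiri_arxiv (h : HasClassicalZeroFreeRegion 5.69693) :
    HasClassicalZeroFreeRegion 5.70176 :=
  HasClassicalZeroFreeRegion.mono (R := 5.69693) (by norm_num) (by norm_num) h

/-- From the two leaves (A), (B) of the proof of Theorem 1.3 (`ExplicitZeroFreeRegion.lean`) every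
classical region with constant `R ≥ 5.558691` follows — in particular Kadiri's and
Mossinghoff–Trudgian's. [cite: MossinghoffTrudgianYangRNT2024, Theorem 1.3 and §9] -/
theorem hasClassicalZeroFreeRegion_of_numerical_rh (hA : platt_trudgian_numerical_rh)
    (hB : zero_free_region_mossinghoff_trudgian_yang_large_height) {R : ℝ} (hR : 5.558691 ≤ R) :
    HasClassicalZeroFreeRegion R :=
  HasClassicalZeroFreeRegion.mono (R := 5.558691) (by norm_num) hR
    (zero_free_region_mossinghoff_trudgian_yang_of_numerical_rh hA hB)

/-! ## (9.2) of Mossinghoff–Trudgian–Yang: the kernel `h^{(1)}_{λ,θ}` -/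

/-- The Heath-Brown/Jang–Kwon auxiliary function of (9.2) of Mossinghoff–Trudgian–Yang (the first
of Heath-Brown's four families of such functions, *Proc. LMS* 64 (1992), in the parametrisation of
Jang–Kwon 2014; used in the proof of Theorem 1.3 with `λ = 1`, `θ = 1.13489`), as an expression
in `u`:
`h^{(1)}_{λ,θ}(u) = λ sec²θ { λ sec²θ (θ/(λ tan θ) − u/2) cos(λu tan θ) + 2θ/tan θ − λu
  + sin(2θ − λu tan θ)/sin 2θ − 2(1 + sin(θ − λu tan θ)/sin θ) }`, "and one requires
`0 < θ < π/2`"; the smoothing functions are `f^{(1)}_{η,λ,θ}(t) = η h^{(1)}_{λ,θ}(ηt)`. In the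
method `d₁(θ)` is the upper limit of integration in `K(w,θ) = ∫_0^{d₁(θ)} (a₁e^{-u} − a₀) h_θ(u)
e^{wu} du` and in `m(θ)` (Mossinghoff–Trudgian 2015, §2); for this kernel MTY "set
`d₁(θ) = 2θ cot θ`", the point where the expression vanishes (`mtyH1_d1` below).
[cite: MossinghoffTrudgianYangRNT2024, §9 eq. (9.2)] [cite: MossinghoffTrudgian2015, §2] -/
def mtyH1 (lam θ u : ℝ) : ℝ :=
  lam / Real.cos θ ^ 2 *
    (lam / Real.cos θ ^ 2 * (θ / (lam * Real.tan θ) - u / 2) * Real.cos (lam * u * Real.tan θ)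
      + 2 * θ / Real.tan θ - lam * u
      + Real.sin (2 * θ - lam * u * Real.tan θ) / Real.sin (2 * θ)
      - 2 * (1 + Real.sin (θ - lam * u * Real.tan θ) / Real.sin θ))

/-- `d₁(θ) = 2θ cot θ`, the support length of `h^{(1)}_{1,θ}` ("since `θ` is now restricted to
`(0, π/2)`, we set `d₁(θ) = 2θ cot θ`", MTY §9). [cite: MossinghoffTrudgianYangRNT2024, §9] -/
def mtyD1 (θ : ℝ) : ℝ :=
  2 * θ * Real.cot θ

/-- **`g₁(θ) = h^{(1)}_{λ,θ}(0)/λ = (θ tan θ + 3θ cot θ − 3) sec²θ`** for `0 < θ < π/2`, `λ ≠ 0`: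
the value at `0` of the kernel (9.2) (MTY §9: "we now have
`g₁(θ) = h^{(1)}_{1,θ}(0) = (θ tan θ + 3θ cot θ − 3) sec²θ`"), which is `λ` times `w(0)` of MTY
(4.3), the tree's `fordSmoothW0 θ`. [cite: MossinghoffTrudgianYangRNT2024, §9 and (4.3)] -/
theorem mtyH1_zero {lam θ : ℝ} (hlam : lam ≠ 0) (hθ : 0 < θ) (hθ' : θ < π / 2) :
    mtyH1 lam θ 0 = lam * fordSmoothW0 θ := by
  have hs : Real.sin θ ≠ 0 := (Real.sin_pos_of_pos_of_lt_pi hθ (by linarith [Real.pi_pos])).ne'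
  have hc : Real.cos θ ≠ 0 := (Real.cos_pos_of_mem_Ioo ⟨by linarith, hθ'⟩).ne'
  have hs2 : Real.sin (2 * θ) ≠ 0 := by
    rw [Real.sin_two_mul]; exact mul_ne_zero (mul_ne_zero two_ne_zero hs) hc
  have htan : Real.tan θ ≠ 0 := by
    rw [Real.tan_eq_sin_div_cos]; exact div_ne_zero hs hc
  -- the two trigonometric relations behind the identity: `1/tan = cot` and
  -- `tan + cot = 1/(cos · sin)` (i.e. `sin² + cos² = 1`), `cos² tan = cos · sin`
  have hrel1 : (Real.tan θ)⁻¹ = Real.cot θ := by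
    rw [Real.tan_eq_sin_div_cos, Real.cot_eq_cos_div_sin, inv_div]
  have hcT : Real.cos θ ^ 2 * Real.tan θ = Real.cos θ * Real.sin θ := by
    rw [Real.tan_eq_sin_div_cos]
    field_simp
  have hTK : Real.tan θ + Real.cot θ = (Real.cos θ * Real.sin θ)⁻¹ := by
    have h1 : Real.sin θ * Real.sin θ + Real.cos θ * Real.cos θ = 1 := by
      rw [← Real.sin_sq_add_cos_sq θ]; ring
    rw [Real.tan_eq_sin_div_cos, Real.cot_eq_cos_div_sin, div_add_div _ _ hc hs, h1, one_div]
  have step : lam / Real.cos θ ^ 2 * (θ / (lam * Real.tan θ)) = θ * (Real.tan θ + Real.cot θ) := by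
    rw [hTK, ← hcT]
    field_simp
  unfold mtyH1 fordSmoothW0
  simp only [mul_zero, zero_mul, sub_zero, zero_div, Real.cos_zero, mul_one, div_self hs2,
    div_self hs]
  rw [step, div_eq_mul_inv (2 * θ) (Real.tan θ), hrel1]
  ring

/-- `g₁(θ) = h^{(1)}_{1,θ}(0) = w(0)` (MTY §9, bullet 2, with (4.3)): the classical-region kernel
at `λ = 1` starts at Ford's `w(0) = (θ tan θ + 3θ cot θ − 3) sec²θ`.
[cite: MossinghoffTrudgianYangRNT2024, §9 and (4.3)] -/
theorem mtyH1_one_zero {θ : ℝ} (hθ : 0 < θ) (hθ' : θ < π / 2) :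
    mtyH1 1 θ 0 = fordSmoothW0 θ := by
  rw [mtyH1_zero one_ne_zero hθ hθ', one_mul]

/-- **The kernel vanishes at `u = d₁(θ)/λ = 2θ cot θ/λ`** (`0 < θ < π/2`, `λ ≠ 0`): there
`λu tan θ = 2θ`, so the four groups of (9.2) are `0`, `0`, `sin 0 / sin 2θ = 0` and
`−2(1 + sin(−θ)/sin θ) = 0`. This is the support endpoint `d₁(θ) = 2θ cot θ` of MTY §9 (for
`λ = 1`). [cite: MossinghoffTrudgianYangRNT2024, §9] -/
theorem mtyH1_d1 {lam θ : ℝ} (hlam : lam ≠ 0) (hθ : 0 < θ) (hθ' : θ < π / 2) :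
    mtyH1 lam θ (mtyD1 θ / lam) = 0 := by
  have hs : Real.sin θ ≠ 0 := (Real.sin_pos_of_pos_of_lt_pi hθ (by linarith [Real.pi_pos])).ne'
  have hc : Real.cos θ ≠ 0 := (Real.cos_pos_of_mem_Ioo ⟨by linarith, hθ'⟩).ne'
  have hkey : lam * (mtyD1 θ / lam) * Real.tan θ = 2 * θ := by
    unfold mtyD1
    rw [Real.cot_eq_cos_div_sin, Real.tan_eq_sin_div_cos]
    field_simp
  have hkey2 : θ / (lam * Real.tan θ) - mtyD1 θ / lam / 2 = 0 := by
    unfold mtyD1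
    rw [Real.cot_eq_cos_div_sin, Real.tan_eq_sin_div_cos]
    field_simp
    ring
  have hkey3 : 2 * θ / Real.tan θ - lam * (mtyD1 θ / lam) = 0 := by
    unfold mtyD1
    rw [Real.cot_eq_cos_div_sin, Real.tan_eq_sin_div_cos]
    field_simp
    ring
  unfold mtyH1
  rw [hkey, hkey2, sub_self, Real.sin_zero, zero_div, show θ - 2 * θ = -θ by ring, Real.sin_neg,
    neg_div, div_self hs]
  simp only [mul_zero, zero_mul, zero_add, add_zero]
  rw [hkey3]
  ring

/-! ## The predicate for `R ≤ 0`, and rh.S09 as "some `R > 0` is admissible" -/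

/-- For `R ≤ 0` the predicate `HasClassicalZeroFreeRegion R` is vacuously TRUE and carries no
information: then `R log|t| ≤ 0` (as `log|t| ≥ log 2 > 0`), so `1/(R log|t|) ≤ 0` (a negative
number, or Lean's junk value `1/0 = 0` at `R = 0`), the hypothesis `1 − 1/(R log|t|) ≤ σ` forces
`σ ≥ 1`, and there `ζ(σ + it) ≠ 0` is Mathlib's `riemannZeta_ne_zero_of_one_le_re`
(Hadamard–de la Vallée Poussin). Only `R > 0` is a claim (cf. `HasClassicalZeroFreeRegion.mono`,
which accordingly assumes `0 < R`). [folklore] -/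
theorem hasClassicalZeroFreeRegion_of_nonpos {R : ℝ} (hR : R ≤ 0) : HasClassicalZeroFreeRegion R := by
  intro σ t ht hσ
  have hlog : 0 < Real.log |t| :=
    (Real.log_pos one_lt_two).trans_le (Real.log_le_log two_pos ht)
  have hRL : R * Real.log |t| ≤ 0 := by nlinarith
  have h1 : 1 / (R * Real.log |t|) ≤ 0 := one_div_nonpos.2 hRL
  exact riemannZeta_ne_zero_of_one_le_re (by simp; linarith)

/-- rh.S09 in de la Vallée Poussin's form (`zero_free_region_classical`: some absolute `c > 0`
with `ζ ≠ 0` on `|t| ≥ 2`, `σ ≥ 1 − c/log|t|`) says exactly that SOME positive constant is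
admissible, `R = 1/c` (`c/log|t| = 1/(R log|t|)`). [cite: MossinghoffTrudgian2015, §1] -/
theorem zero_free_region_classical_iff_exists_hasClassicalZeroFreeRegion :
    zero_free_region_classical ↔ ∃ R : ℝ, 0 < R ∧ HasClassicalZeroFreeRegion R := by
  constructor
  · rintro ⟨c, hc, h⟩
    refine ⟨1 / c, by positivity, fun σ t ht hσ ↦ h σ t ht ?_⟩
    have hlog : 0 < Real.log |t| :=
      (Real.log_pos one_lt_two).trans_le (Real.log_le_log two_pos ht)
    have key : 1 / (1 / c * Real.log |t|) = c / Real.log |t| := by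
      field_simp
    rwa [key] at hσ
  · rintro ⟨R, hR, h⟩
    refine ⟨1 / R, by positivity, fun σ t ht hσ ↦ h σ t ht ?_⟩
    rwa [div_div] at hσ

/-- **Unconditionally, some constant is admissible**: rh.S09 is a theorem of the tree
(`zero_free_region_classical_holds`, `ZetaZeroFreeRegion.lean`: the de la Vallée Poussin–Landau
argument of Montgomery–Vaughan, Theorem 6.6, specialised to `ζ`, with an inexplicit constant), so
`∃ R > 0, HasClassicalZeroFreeRegion R` holds outright. The explicit constant `5.558691` remains
a named fact (conditional on the computational leaf (A) only, `ExplicitZeroFreeRegionRoundsProofs.lean`),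
with `5.573412` and Kadiri's `5.69693` its corollaries: the local method behind rh.S09 yields a far
larger `R`. [cite: MontgomeryVaughan2007, Theorem 6.6] -/
theorem exists_hasClassicalZeroFreeRegion : ∃ R : ℝ, 0 < R ∧ HasClassicalZeroFreeRegion R :=
  zero_free_region_classical_iff_exists_hasClassicalZeroFreeRegion.1 zero_free_region_classical_holds

/-- Conversely each explicit constant gives rh.S09 with that witness: `HasClassicalZeroFreeRegion R`
for some `R > 0` implies `zero_free_region_classical` (with `c = 1/R`); e.g. from Kadiri's region
`R = 5.69693`. [cite: Kadiri2005, Théorème 1.1] -/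
theorem zero_free_region_classical_of_kadiri (h : HasClassicalZeroFreeRegion 5.69693) :
    zero_free_region_classical :=
  zero_free_region_classical_iff_exists_hasClassicalZeroFreeRegion.2 ⟨5.69693, by norm_num, h⟩

end Literature.NumberTheory.LFunctions
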